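import Literature.NumberTheory.LFunctions.ExplicitSiegelZeroBoundImaginaryQuadratic
import Literature.NumberTheory.LFunctions.GoldfeldSchinzelLowerHalfExplicit
import Literature.NumberTheory.LFunctions.PrimitiveQuadraticCharacterKronecker
import Literature.NumberTheory.QuadraticFields.ReducedFormsTwoPowOmegaCensus
import Literature.NumberTheory.Multiplicative.SquarefreeHarmonicSums
import Literature.NumberTheory.QuadraticFields.ClassNumberLeSqrtMulLog
import Literature.NumberTheory.QuadraticFields.DedekindZetaReducedForms
import HarnessLib

/-!
# Ralaivaosaona–Razakarinoro 2026, Theorem 2 — PROVED: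
# `1 − β > (2π + o(1)) h(−d)/((log h(−d))² √d)` as `h(−d) → ∞`

Topic `Literature/NumberTheory/LFunctions` (namespace `Literature.NumberTheory.LFunctions`, helpers in the
sub-namespace `ClassSumRepulsion`). PROOF LAYER for the statement file
`ExplicitSiegelZeroBoundImaginaryQuadratic.lean` (cell `parity-realchar`, SIEGEL INSTRUMENT, conditionals topic
I.1 «class numbers»): the named fact

* `ralaivaosaonaRazakarinoro2026_theorem2` — D. Ralaivaosaona, F. B. Razakarinoro, *An explicit bound for Siegel
  zeros and the torsion of elliptic curves with complex multiplication*, J. Number Theory **281** (2026)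
  795–829, Theorem 2 (p. 797): "Let `d` and `β` be as in Theorem 1 [`d > 3·10⁸`, `−d` a fundamental
  discriminant, `χ = (−d/·)`, `β > 0` with `L(β, χ) = 0`] and let `h(−d)` be the class number of the
  quadratic field `ℚ(√−d)`. Then, we have `1 − β > (2π + o(1)) h(−d)/((log h(−d))² √d)` as `h(−d) → ∞`."
  (typed with `∀ ε > 0 ∃ h₀ ∀ … h_K ≥ h₀ : (2π − ε) h_K/((log h_K)² √d) < 1 − β` over imaginary quadratic
  fields `K`)

is discharged here as `theorem ralaivaosaonaRazakarinoro2026_theorem2_holds : ralaivaosaonaRazakarinoro2026_theorem2`.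
The statement file is untouched; the typed `Prop` is proved literally. Everything in this file is PROVED
(theorems only; no definition, no named fact, no new hypothesis).

## Source and road (as printed, §4 pp. 817–818), and the road taken here

PRINT (p. 817): "We begin with the following consequence of Theorem 1 in [18] [Goldfeld–Schinzel]: if `β`
exists, then `1 − β ≥ (6/π² + o(1)) L(1,χ)/Σ_{a ≤ ¼√d} ν(a)/a` as `d → ∞` (40). … for any `1 ≤ x ≤ ½√d`,
we have `Σ_{a ≤ x} ν(a)/a ≤ Σ_{a ≤ y} 2^{w(a)}/a` whenever `Σ_{a ≤ y} 2^{w(a)} ≥ h(−d)` (41). This is because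
the sum is larger if more ideals have smaller norms. … **Lemma 5** (Montgomery and Vaughan). As `y → ∞`,
`Σ_{n ≤ y} 2^{w(n)} = (6/π²) y log y + O(y)` and `Σ_{n ≤ y} 2^{w(n)}/n = (3/π²)(log y)² + O(log y)`. …
*Proof of Theorem 2.* We choose `y = y(d)` in such a way that `Σ_{a ≤ y−1} 2^{w(a)} < h(−d) ≤ Σ_{a ≤ y} 2^{w(a)}`
… (42) … `Σ_{a ≤ ¼√d} ν(a)/a ≤ (3/π² + O(log log h/(log h)²))(log h(−d))²`. Plugging this into (40) yields
`1 − β ≥ (2 + o(1)) L(1,χ)/(log h(−d))²`, and the proof of Theorem 2 is complete using the class number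
formula. □"

HERE, in the same order:

* **(40) — Goldfeld–Schinzel, lower half.** The tree's KERNEL theorem
  `ClassSumRepulsion.one_sub_realZero_mul_sum_gt_classNumber` (`GoldfeldSchinzelLowerHalfExplicit.lean`):
  at every real zero `β ∈ [9/10, 1)` of `L(s, χ)`, `χ` the odd real primitive character mod `d > 4`,
  `h(−d) < (1−β)(1 + 5(1−β))·(π/6)√d·Σ_{Q reduced} 1/a_Q` — Goldfeld–Schinzel's main term `6/π²·L(1,χ)/Σ'`
  EXACTLY (class number formula `L(1,χ) = πh/√d` already folded in), with the printed `o(1)` replaced by the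
  explicit factor `(1 + 5(1−β))⁻¹`, and `Σ'` enlarged to the sum over ALL reduced forms (weaker, safe).
* **(41) + Lemma 5.** `Σ_{Q reduced} 1/a_Q ≤ h/(h+1) + Σ_{n ≤ h} 2^{ω(n)}/n` — the tree's rearrangement lemma
  with the SHARP fibre count `#{Q : a_Q = n} ≤ ν(n) ≤ 2^{ω(n)}` (R–R Lemma 1;
  `QuadraticFields/ReducedFormsTwoPowOmegaCensus.lean`, this seat) at `y = h` (which satisfies
  `Σ_{a ≤ y} 2^{w(a)} ≥ h` trivially — the optimisation (42) of `y` only affects lower-order terms) — and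
  `Σ_{n ≤ h} 2^{ω(n)}/n ≤ (3/π²)(log h)² + 23 log h + 45` (Lemma 5, upper half with explicit secondary constants;
  `Multiplicative/SquarefreeHarmonicSums.lean`, this seat). Hence (`sum_inv_fst_le_log_sq_sharp`)
  `Σ_Q 1/a_Q ≤ (3/π²)(log h)² + 23 log h + 46` and (`classNumber_lt_log_sq_sharp`)
  **`h(−d) < (1−β)(1+5(1−β))·(π/6)√d·((3/π²) log²h + 23 log h + 46)`** — i.e.
  `1 − β > 2π·h/(√d log²h)·(1 + 5(1−β))⁻¹(1 + O(1/log h))⁻¹`, explicit and valid for EVERY `d > 4`.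
* **The `o(1)` bookkeeping** (`one_sub_realZero_gt_of_classNumber_ge`): for `ε > 0` put `c = ε/(2π)` and
  `h₀ = ⌈exp(6000/ε)⌉`. For `h ≥ h₀` the secondary terms are `≤ (c/4)·(3/π²)log²h`; the quantity
  `X = 2πh/(√d log²h)` is `≤ c/20` (if `d ≤ h⁴`: `h ≤ √d log d/π` [Oesterlé's class number ceiling, tree
  `Quadratic.classNumber_le_sqrt_mul_log`, taken here as a hypothesis on the form side] and `log h ≥ ¼ log d`
  give `X ≤ 32/log d ≤ c/20`; if `h⁴ < d`: `X ≤ 2π/h ≤ c/20`); so either `1 − β > c/20 ≥ X(1 − c)`, or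
  `1 − β ≤ c/20`, `β ≥ 9/10`, and the displayed inequality gives
  `(1 − c)·X < (1 − c)(1 + 5(1−β))(1 + c/4)(1 − β) ≤ (1 − β)`. Zeros `β ≤ 9/10` are covered by the first case.
* **Field side** (`ralaivaosaonaRazakarinoro2026_theorem2_holds`): `h(d_K) = h_K` (Cox Thm 7.7,
  `Quadratic.card_reducedForms_eq_classNumber`), `h_K ≤ π⁻¹√|d_K| log|d_K|` (`Quadratic.classNumber_le_sqrt_mul_log`).

READING NOTES. (i) The typed fact quantifies over every real `β > 0` with `L(β, χ) = 0` (not only the largest),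
as does the proof above. (ii) The printed hypothesis `d > 3·10⁸` of Theorem 1 is carried by the typed
statement but not used (only `d > 4`). (iii) No effectivity is lost: `h₀ = ⌈exp(6000/ε)⌉` is explicit (the
source: "It is also possible to obtain an explicit bound for the `o(1)` term in (3) in terms of `h(−d)`").
(iv) Not Siegel-vacuous: the bound is of strength `1/log³ d`, far above Siegel's `d^{−ε}`.

LABEL (cell rule): conditionals column I.1, kernel, hypothesis-free; debt −1. WHAT THIS IS NOT: nothing for
even characters; no lower bound for `h(−d)`; nothing here bears on parity (H5).

## References

* [RalaivaosaonaRazakarinoro2026] Theorem 2 (p. 797); §4 (40)–(42), Lemma 5 (pp. 817–818); Lemma 1 (p. 802).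
* [GoldfeldSchinzel1975] Theorem 1 (case `d < 0`).
* [MontgomeryVaughan2007] §2.1.1 Exercise 15 (b) (Lemma 5).
* [Oesterle1988Gauss] II §3 (27) (`h_K ≤ π⁻¹√|d_K| log|d_K|`, tree).
* [Cox2013] Thm 7.7(ii) (`h(d_K) = h_K`, tree).
-/

noncomputable section

open Complex Finset
open Literature.NumberTheory.QuadraticFields Literature.NumberTheory.QuadraticFields.Quadratic
open Literature.NumberTheory.QuadraticFields.BinaryQuadraticForm (reducedForms mem_reducedForms_iff)
open Literature.NumberTheory.LFunctions.PrimitiveQuadratic (isFundamentalDiscriminant_neg)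
open Literature.NumberTheory.Multiplicative.SquarefreeHarmonic (sum_two_pow_omega_div_le)

namespace Literature.NumberTheory.LFunctions

namespace ClassSumRepulsion

/-! ### The sharp census at the conductor of an odd real primitive character -/

/-- `−d` is a fundamental discriminant in the shape used by `SquareRootsModuloCount` (for the conductor of an
odd real primitive character). [cite: MontgomeryVaughan2007, Theorem 9.13] -/
private theorem fundamental_neg' {d : ℕ} [NeZero d] {χ : DirichletCharacter ℂ d}
    (hprim : χ.IsPrimitive) (hquad : χ.IsQuadratic) (hodd : χ.Odd) :
    ((-(d : ℤ)) % 4 = 1 ∧ Squarefree (-(d : ℤ))) ∨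
      (4 ∣ (-(d : ℤ)) ∧ ((-(d : ℤ)) / 4 % 4 = 2 ∨ (-(d : ℤ)) / 4 % 4 = 3) ∧ Squarefree ((-(d : ℤ)) / 4)) := by
  rcases isFundamentalDiscriminant_neg hprim hquad hodd with ⟨h1, h2, -⟩ | ⟨h1, h2, h3⟩
  · exact Or.inl ⟨h1, h2⟩
  · exact Or.inr ⟨h1, h2, h3⟩

/-- `h(−d) ≥ 1` for the conductor `d` of an odd real primitive character. [folklore] -/
private theorem classNumber_pos' {d : ℕ} [NeZero d] (hd : 4 < d) {χ : DirichletCharacter ℂ d}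
    (hprim : χ.IsPrimitive) (hquad : χ.IsQuadratic) (hodd : χ.Odd) :
    0 < BinaryQuadraticForm.classNumber (-(d : ℤ)) := by
  have hD0 : (-(d : ℤ)) < 0 := by omega
  refine BinaryQuadraticForm.classNumber_pos hD0 ?_
  rcases isFundamentalDiscriminant_neg hprim hquad hodd with ⟨h1, -, -⟩ | ⟨h0, -, -⟩
  · exact Or.inr h1
  · exact Or.inl (Int.emod_eq_zero_of_dvd h0)

/-- **Sharp census: `Σ_{Q reduced} 1/a_Q ≤ (3/π²)(log h)² + 23 log h + 46`**, `h = h(−d)`, for the conductor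
`d > 4` of an odd real primitive character ((41) at `y = h`, `ν(a) ≤ 2^{ω(a)}`, and Lemma 5's upper half).
[cite: RalaivaosaonaRazakarinoro2026, (41) and Lemma 5 (p. 817)] -/
theorem sum_inv_fst_le_log_sq_sharp {d : ℕ} [NeZero d] (hd : 4 < d) {χ : DirichletCharacter ℂ d}
    (hprim : χ.IsPrimitive) (hquad : χ.IsQuadratic) (hodd : χ.Odd) :
    ∑ Q ∈ reducedForms (-(d : ℤ)), (1 : ℝ) / (Q.1 : ℝ) ≤
      3 / Real.pi ^ 2 * Real.log (BinaryQuadraticForm.classNumber (-(d : ℤ))) ^ 2 +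
        23 * Real.log (BinaryQuadraticForm.classNumber (-(d : ℤ))) + 46 := by
  set h : ℕ := BinaryQuadraticForm.classNumber (-(d : ℤ)) with hh
  have hD0 : (-(d : ℤ)) < 0 := by omega
  have hpos : 1 ≤ h := classNumber_pos' hd hprim hquad hodd
  have hcensus := BinaryQuadraticForm.LeadingCoeff.sum_inv_fst_le_sum_two_pow_omega_div hD0
    (fundamental_neg' hprim hquad hodd) h
  rw [← hh] at hcensus
  have hT := sum_two_pow_omega_div_le hpos
  have hfrac : (h : ℝ) / ((h : ℝ) + 1) ≤ 1 := by
    rw [div_le_one (by positivity)]; linarith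
  linarith

/-- **Goldfeld–Schinzel + sharp census**: at every real zero `β ∈ [9/10, 1)` of `L(s, χ)`, `χ` the odd real
primitive character mod `d > 4`, with `h = h(−d)`:
`h < (1−β)(1 + 5(1−β))·(π/6)·√d·((3/π²)(log h)² + 23 log h + 46)` — i.e.
`1 − β > 2π·h/(√d·(log²h + (π²/3)(23 log h + 46)))·(1 + 5(1−β))⁻¹`, explicit for every `d`.
[cite: RalaivaosaonaRazakarinoro2026, Theorem 2 and §4 (40)–(41)] [cite: GoldfeldSchinzel1975, Theorem 1 (case d < 0)] -/
theorem classNumber_lt_log_sq_sharp {d : ℕ} [NeZero d] (hd : 4 < d)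
    {χ : DirichletCharacter ℂ d} (hprim : χ.IsPrimitive) (hquad : χ.IsQuadratic) (hodd : χ.Odd)
    {β : ℝ} (hβ9 : 9 / 10 ≤ β) (hβ1 : β < 1) (hz : χ.LFunction β = 0) :
    (BinaryQuadraticForm.classNumber (-(d : ℤ)) : ℝ) <
      (1 - β) * (1 + 5 * (1 - β)) * (Real.pi / 6) * Real.sqrt d *
        (3 / Real.pi ^ 2 * Real.log (BinaryQuadraticForm.classNumber (-(d : ℤ))) ^ 2 +
          23 * Real.log (BinaryQuadraticForm.classNumber (-(d : ℤ))) + 46) := by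
  have hmain := one_sub_realZero_mul_sum_gt_classNumber hd hprim hquad hodd hβ9 hβ1 hz
  have hS := sum_inv_fst_le_log_sq_sharp hd hprim hquad hodd
  have hδ0 : 0 < 1 - β := by linarith
  have hd4R : (4 : ℝ) < d := by exact_mod_cast hd
  have hsd0 : 0 < Real.sqrt d := Real.sqrt_pos.2 (by linarith)
  have hA : 0 ≤ (1 - β) * (1 + 5 * (1 - β)) * (Real.pi / 6) * Real.sqrt d := by
    have := Real.pi_pos; positivity
  have := mul_le_mul_of_nonneg_left hS hA
  nlinarith

/-! ### The `o(1)` bookkeeping -/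

/-- Numerical facts about `π` used below: `π² < 10`, `1280 π ≤ 6000`, `80 π² ≤ 6000`, `920 π ≤ 3000`.
[folklore] -/
private theorem pi_facts : Real.pi ^ 2 < 10 ∧ 1280 * Real.pi ≤ 6000 ∧ 80 * Real.pi ^ 2 ≤ 6000 ∧
    920 * Real.pi ≤ 3000 := by
  have h1 := Real.pi_lt_d2
  have h2 := Real.pi_pos
  refine ⟨by nlinarith, by nlinarith, by nlinarith, by nlinarith⟩

/-- An odd character is non-trivial, so `β < 1` at every real zero of its `L`-function. [folklore] -/
private theorem lt_one_of_zero {d : ℕ} [NeZero d] (χ : DirichletCharacter ℂ d) (hodd : χ.Odd) {β : ℝ}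
    (hz : χ.LFunction β = 0) : β < 1 := by
  by_contra hcon
  push Not at hcon
  have hne : χ ≠ 1 := by
    intro h
    have h1 : χ (-1) = -1 := hodd
    rw [h, MulChar.one_apply (isUnit_one.neg)] at h1
    norm_num at h1
  exact DirichletCharacter.LFunction_ne_zero_of_one_le_re χ (Or.inl hne) (s := β) (by simpa using hcon) hz

/-- The secondary terms of the census are absorbed: `(3/π²)L² + 23L + 46 ≤ (1 + c/4)(3/π²)L²` once `L ≥ 1`
and `cL ≥ 920`. [folklore] -/
private theorem census_le_main {L c : ℝ} (hL1 : 1 ≤ L) (hcL : 920 ≤ c * L) :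
    3 / Real.pi ^ 2 * L ^ 2 + 23 * L + 46 ≤ (1 + c / 4) * (3 / Real.pi ^ 2 * L ^ 2) := by
  obtain ⟨hπ10, -, -, -⟩ := pi_facts
  have hπ2 : 0 < Real.pi ^ 2 := by positivity
  -- `(c/4)(3/π²)L² ≥ (3/40)(cL)L ≥ 69 L ≥ 23 L + 46`
  have hq : 3 / (10 : ℝ) ≤ 3 / Real.pi ^ 2 := div_le_div_of_nonneg_left (by norm_num) hπ2 hπ10.le
  have hL0 : 0 ≤ L := by linarith
  have h1 : 69 * L ≤ c / 4 * (3 / 10 * L ^ 2) := by nlinarith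
  have h2 : c / 4 * (3 / 10 * L ^ 2) ≤ c / 4 * (3 / Real.pi ^ 2 * L ^ 2) := by
    have hc0 : 0 ≤ c := by nlinarith
    have : 3 / 10 * L ^ 2 ≤ 3 / Real.pi ^ 2 * L ^ 2 := mul_le_mul_of_nonneg_right hq (by positivity)
    exact mul_le_mul_of_nonneg_left this (by positivity)
  nlinarith

/-- Case `d ≤ h⁴` of the smallness of `X = 2πh/(L²√d)`: with `h ≤ √d·log d/π`, `log d ≤ 4L` and
`ε·log d ≥ 6000`, `X ≤ 2 log d/L² ≤ 32/log d ≤ c/20` (`c = ε/(2π)`). [folklore] -/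
private theorem X_le_of_log_le {ε c L h sd ld : ℝ} (hπc : c = ε / (2 * Real.pi))
    (hsd : 0 < sd) (hL : 0 < L) (hld : 0 < ld)
    (hub : h ≤ sd * ld / Real.pi) (hlogd : ld ≤ 4 * L) (hεld : 6000 ≤ ε * ld) :
    2 * Real.pi * h / (L ^ 2 * sd) ≤ c / 20 := by
  have hπ := Real.pi_pos
  obtain ⟨-, h1280, -, -⟩ := pi_facts
  have hub' : h * Real.pi ≤ sd * ld := (le_div_iff₀ hπ).mp hub
  have h1 : 2 * Real.pi * h / (L ^ 2 * sd) ≤ 2 * ld / L ^ 2 := by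
    rw [div_le_div_iff₀ (by positivity) (by positivity)]
    calc 2 * Real.pi * h * L ^ 2 = 2 * (h * Real.pi) * L ^ 2 := by ring
      _ ≤ 2 * (sd * ld) * L ^ 2 := by gcongr
      _ = 2 * ld * (L ^ 2 * sd) := by ring
  have h2 : 2 * ld / L ^ 2 ≤ 32 / ld := by
    rw [div_le_div_iff₀ (by positivity) hld]
    have : ld * ld ≤ 16 * L ^ 2 := by nlinarith
    nlinarith
  have h3 : 32 / ld ≤ c / 20 := by
    rw [div_le_div_iff₀ hld (by norm_num)]
    have hcld : 640 ≤ c * ld := by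
      rw [hπc, div_mul_eq_mul_div, le_div_iff₀ (by positivity)]
      nlinarith
    nlinarith
  exact h1.trans (h2.trans h3)

/-- Case `h⁴ < d` of the smallness of `X`: with `h² ≤ √d`, `L ≥ 1` and `h ≥ L₀ = 6000/ε`,
`X ≤ 2π/h ≤ 2π/L₀ ≤ c/20`. [folklore] -/
private theorem X_le_of_sq_le {ε c L h sd L₀ : ℝ} (hπc : c = ε / (2 * Real.pi)) (hε : 0 < ε)
    (hL₀ : L₀ = 6000 / ε) (hh0 : 0 < h) (hsd : 0 < sd) (hL1 : 1 ≤ L)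
    (hh2 : h ^ 2 ≤ sd) (hhL₀ : L₀ ≤ h) :
    2 * Real.pi * h / (L ^ 2 * sd) ≤ c / 20 := by
  have hπ := Real.pi_pos
  obtain ⟨-, -, h80, -⟩ := pi_facts
  have hL₀pos : 0 < L₀ := by rw [hL₀]; positivity
  have h1 : 2 * Real.pi * h / (L ^ 2 * sd) ≤ 2 * Real.pi / h := by
    rw [div_le_div_iff₀ (by positivity) hh0]
    have hsq : h * h ≤ sd := by nlinarith
    have hL2 : 1 ≤ L ^ 2 := one_le_pow₀ hL1
    have : h * h ≤ L ^ 2 * sd := le_trans hsq (le_mul_of_one_le_left hsd.le hL2)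
    nlinarith
  have h2 : 2 * Real.pi / h ≤ 2 * Real.pi / L₀ := div_le_div_of_nonneg_left (by positivity) hL₀pos hhL₀
  have h3 : 2 * Real.pi / L₀ ≤ c / 20 := by
    rw [hπc, hL₀, div_div_eq_mul_div, div_div, div_le_div_iff₀ (by norm_num) (by positivity)]
    nlinarith [mul_le_mul_of_nonneg_right h80 hε.le]
  exact h1.trans (h2.trans h3)

/-- From the displayed inequality to `X < δ(1+5δ)(1+c/4)`. [folklore] -/
private theorem X_lt_of_main {h δ sd L c : ℝ} (hsd : 0 < sd) (hL : 0 < L)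
    (hGS : h < δ * (1 + 5 * δ) * (Real.pi / 6) * sd * ((1 + c / 4) * (3 / Real.pi ^ 2 * L ^ 2))) :
    2 * Real.pi * h / (L ^ 2 * sd) < δ * (1 + 5 * δ) * (1 + c / 4) := by
  have hπ := Real.pi_pos
  rw [div_lt_iff₀ (by positivity)]
  have e : 2 * Real.pi * (δ * (1 + 5 * δ) * (Real.pi / 6) * sd * ((1 + c / 4) * (3 / Real.pi ^ 2 * L ^ 2))) =
      δ * (1 + 5 * δ) * (1 + c / 4) * (L ^ 2 * sd) := by
    field_simp
    ring
  calc 2 * Real.pi * h < 2 * Real.pi * (δ * (1 + 5 * δ) * (Real.pi / 6) * sd *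
        ((1 + c / 4) * (3 / Real.pi ^ 2 * L ^ 2))) := mul_lt_mul_of_pos_left hGS (by positivity)
    _ = δ * (1 + 5 * δ) * (1 + c / 4) * (L ^ 2 * sd) := e

/-- The near-zero algebra: `X < δ(1+5δ)(1+c/4)`, `5δ ≤ c/4`, `0 < c < 1` give `(1 − c)X < δ`. [folklore] -/
private theorem near_algebra {X δ c : ℝ} (hc0 : 0 < c) (hc1 : c < 1) (hδ0 : 0 < δ)
    (h5δ : 5 * δ ≤ c / 4) (hX : X < δ * (1 + 5 * δ) * (1 + c / 4)) : (1 - c) * X < δ := by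
  have hprod : (1 - c) * ((1 + 5 * δ) * (1 + c / 4)) ≤ 1 := by
    have h1 : (1 + 5 * δ) * (1 + c / 4) ≤ (1 + c / 4) * (1 + c / 4) :=
      mul_le_mul_of_nonneg_right (by linarith) (by positivity)
    have h2 : (1 - c) * ((1 + c / 4) * (1 + c / 4)) ≤ 1 := by
      nlinarith [mul_nonneg (mul_nonneg hc0.le hc0.le) hc0.le, sq_nonneg c]
    exact le_trans (mul_le_mul_of_nonneg_left h1 (by linarith)) h2
  calc (1 - c) * X < (1 - c) * (δ * (1 + 5 * δ) * (1 + c / 4)) := mul_lt_mul_of_pos_left hX (by linarith)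
    _ = δ * ((1 - c) * ((1 + 5 * δ) * (1 + c / 4))) := by ring
    _ ≤ δ * 1 := mul_le_mul_of_nonneg_left hprod hδ0.le
    _ = δ := mul_one δ

/-- **The asymptotic on the form side.** For every `ε > 0` there is `h₀` (namely `⌈exp(6000/ε)⌉`) such that
for every conductor `d > 4` of an odd real primitive character `χ`, every real `β` with `L(β, χ) = 0`, if
`h = h(−d) ≥ h₀` and `h ≤ √d·log d/π`, then `(2π − ε)·h/((log h)²√d) < 1 − β`.
[cite: RalaivaosaonaRazakarinoro2026, Theorem 2 (proof, §4)] -/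
theorem one_sub_realZero_gt_of_classNumber_ge {ε : ℝ} (hε : 0 < ε) :
    ∃ h₀ : ℕ, ∀ (d : ℕ) [NeZero d], 4 < d → ∀ χ : DirichletCharacter ℂ d,
      χ.IsPrimitive → χ.IsQuadratic → χ.Odd → ∀ β : ℝ, χ.LFunction β = 0 →
        h₀ ≤ BinaryQuadraticForm.classNumber (-(d : ℤ)) →
        (BinaryQuadraticForm.classNumber (-(d : ℤ)) : ℝ) ≤ Real.sqrt d * Real.log d / Real.pi →
        (2 * Real.pi - ε) * (BinaryQuadraticForm.classNumber (-(d : ℤ)) : ℝ) /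
            (Real.log (BinaryQuadraticForm.classNumber (-(d : ℤ))) ^ 2 * Real.sqrt d) < 1 - β := by
  have hπ := Real.pi_pos
  -- trivial when `ε ≥ 2π`
  by_cases hε2 : 2 * Real.pi ≤ ε
  · refine ⟨0, fun d _ hd χ hprim hquad hodd β hz _ _ => ?_⟩
    have hβ1 := lt_one_of_zero χ hodd hz
    have hnum : (2 * Real.pi - ε) * (BinaryQuadraticForm.classNumber (-(d : ℤ)) : ℝ) ≤ 0 :=
      mul_nonpos_of_nonpos_of_nonneg (by linarith) (by positivity)
    have : (2 * Real.pi - ε) * (BinaryQuadraticForm.classNumber (-(d : ℤ)) : ℝ) /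
        (Real.log (BinaryQuadraticForm.classNumber (-(d : ℤ))) ^ 2 * Real.sqrt d) ≤ 0 :=
      div_nonpos_of_nonpos_of_nonneg hnum (by positivity)
    linarith
  push Not at hε2
  -- `c = ε/(2π) ∈ (0, 1)`, `L₀ = 6000/ε`, `h₀ = ⌈exp L₀⌉`
  set c : ℝ := ε / (2 * Real.pi) with hc
  have hc0 : 0 < c := by positivity
  have hc1 : c < 1 := by rw [hc, div_lt_one (by positivity)]; exact hε2
  have hεc : ε = 2 * Real.pi * c := by rw [hc]; field_simp
  set L₀ : ℝ := 6000 / ε with hL₀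
  have hL₀pos : 0 < L₀ := by positivity
  have hεL₀ : ε * L₀ = 6000 := by rw [hL₀]; field_simp
  have hL₀1 : 1 ≤ L₀ := by
    rw [hL₀, le_div_iff₀ hε]; nlinarith [Real.pi_lt_d2]
  refine ⟨⌈Real.exp L₀⌉₊, fun d _ hd χ hprim hquad hodd β hz hh hub => ?_⟩
  have hβ1 := lt_one_of_zero χ hodd hz
  -- sizes: `h ≥ exp L₀`, `L = log h ≥ L₀ ≥ 1`
  have hhexp : Real.exp L₀ ≤ (BinaryQuadraticForm.classNumber (-(d : ℤ)) : ℝ) :=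
    (Nat.le_ceil _).trans (by exact_mod_cast hh)
  have hhL₀ : L₀ ≤ (BinaryQuadraticForm.classNumber (-(d : ℤ)) : ℝ) :=
    le_trans (by linarith [Real.add_one_le_exp L₀]) hhexp
  have hh0 : (0 : ℝ) < BinaryQuadraticForm.classNumber (-(d : ℤ)) := by linarith
  have hLL₀ : L₀ ≤ Real.log (BinaryQuadraticForm.classNumber (-(d : ℤ))) := by
    rw [Real.le_log_iff_exp_le hh0]; exact hhexp
  have hL1 : 1 ≤ Real.log (BinaryQuadraticForm.classNumber (-(d : ℤ))) := hL₀1.trans hLL₀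
  have hd4R : (4 : ℝ) < d := by exact_mod_cast hd
  have hd0 : (0 : ℝ) < d := by linarith
  have hsd : 0 < Real.sqrt d := Real.sqrt_pos.2 hd0
  have hlogd0 : 0 < Real.log d := Real.log_pos (by linarith)
  -- abbreviations (plain `have`s with equations, to keep later contexts small)
  obtain ⟨h, hh_def⟩ : ∃ h : ℝ, h = (BinaryQuadraticForm.classNumber (-(d : ℤ)) : ℝ) := ⟨_, rfl⟩
  obtain ⟨L, hL_def⟩ : ∃ L : ℝ, L = Real.log (BinaryQuadraticForm.classNumber (-(d : ℤ))) := ⟨_, rfl⟩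
  rw [← hh_def] at hhexp hhL₀ hh0 hub
  rw [← hL_def, ← hh_def]
  rw [← hL_def] at hLL₀ hL1
  have hL0 : 0 < L := by linarith
  have hεL : 6000 ≤ ε * L := by nlinarith
  have hcL : 920 ≤ c * L := by
    obtain ⟨-, -, -, h920⟩ := pi_facts
    have e : c * L = ε * L / (2 * Real.pi) := by rw [hc]; ring
    rw [e, le_div_iff₀ (by positivity)]
    nlinarith
  -- the quantity `X = 2πh/(L²√d)` is at most `c/20`
  have hX : 2 * Real.pi * h / (L ^ 2 * Real.sqrt d) ≤ c / 20 := by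
    by_cases hA : (d : ℝ) ≤ h ^ 4
    · -- `log d ≤ 4L` and `log d ≥ L₀` since `d > h`
      have hlogd : Real.log d ≤ 4 * L := by
        have e : Real.log (h ^ 4) = 4 * L := by
          rw [Real.log_pow, hL_def, hh_def]; norm_num
        rw [← e]; exact Real.log_le_log hd0 hA
      have hdh : h < d := by
        -- `h ≤ √d log d/π ≤ √d · 2√d/π = 2d/π < d`
        have hlog_sqrt : Real.log d ≤ 2 * Real.sqrt d := by
          have h1 : Real.log (Real.sqrt d) ≤ Real.sqrt d - 1 := Real.log_le_sub_one_of_pos hsd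
          have h2 : Real.log (Real.sqrt d) = Real.log d / 2 := Real.log_sqrt hd0.le
          linarith
        have hsq : Real.sqrt d * Real.sqrt d = d := Real.mul_self_sqrt hd0.le
        have hub' : h * Real.pi ≤ Real.sqrt d * Real.log d := (le_div_iff₀ hπ).mp hub
        have : h * Real.pi ≤ 2 * d := by nlinarith
        nlinarith [Real.pi_gt_three]
      have hlogdL₀ : L₀ ≤ Real.log d := by
        have : L ≤ Real.log d := by rw [hL_def, ← hh_def]; exact Real.log_le_log hh0 hdh.le
        linarith
      have hεld : 6000 ≤ ε * Real.log d := by nlinarith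
      exact X_le_of_log_le hc hsd hL0 hlogd0 hub hlogd hεld
    · -- `h⁴ < d`: `h² < √d`
      push Not at hA
      have hh2 : h ^ 2 ≤ Real.sqrt d := by
        rw [Real.le_sqrt (by positivity) hd0.le]
        nlinarith
      exact X_le_of_sq_le hc hε hL₀ hh0 hsd hL1 hh2 hhL₀
  -- the goal is `(1 − c)·X < δ`
  have hgoal : (2 * Real.pi - ε) * h / (L ^ 2 * Real.sqrt d) =
      (1 - c) * (2 * Real.pi * h / (L ^ 2 * Real.sqrt d)) := by
    rw [hεc]; ring
  rw [hgoal]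
  have hX0 : 0 ≤ 2 * Real.pi * h / (L ^ 2 * Real.sqrt d) := by positivity
  by_cases hfar : c / 20 < 1 - β
  · -- far zeros (including all `β < 9/10`): `(1 − c)X ≤ X ≤ c/20 < 1 − β`
    nlinarith
  · -- near zeros: `1 − β ≤ c/20 < 1/20`, so `β ≥ 9/10`; Goldfeld–Schinzel with the sharp census
    push Not at hfar
    have hβ9 : 9 / 10 ≤ β := by linarith
    have hδ0 : 0 < 1 - β := by linarith
    have hGS := classNumber_lt_log_sq_sharp hd hprim hquad hodd hβ9 hβ1 hz
    rw [← hL_def, ← hh_def] at hGS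
    have hmain := census_le_main hL1 hcL
    have hA0 : 0 ≤ (1 - β) * (1 + 5 * (1 - β)) * (Real.pi / 6) * Real.sqrt d := by positivity
    have hGS' : h < (1 - β) * (1 + 5 * (1 - β)) * (Real.pi / 6) * Real.sqrt d *
        ((1 + c / 4) * (3 / Real.pi ^ 2 * L ^ 2)) :=
      lt_of_lt_of_le hGS (mul_le_mul_of_nonneg_left hmain hA0)
    have hXlt := X_lt_of_main hsd hL0 hGS'
    exact near_algebra hc0 hc1 hδ0 (by linarith) hXlt

end ClassSumRepulsion

/-! ### The discharge -/

open ClassSumRepulsion in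
/-- **Ralaivaosaona–Razakarinoro 2026, Theorem 2 — PROVED** (`ralaivaosaonaRazakarinoro2026_theorem2_holds`):
for every `ε > 0` there is `h₀` such that for every imaginary quadratic field `K` with `|d_K| > 3·10⁸` and
`h_K ≥ h₀`, the odd real primitive character `χ` mod `|d_K|` and every real `β > 0` with `L(β, χ) = 0`:
`(2π − ε)·h_K/((log h_K)²√|d_K|) < 1 − β`. Road: Goldfeld–Schinzel's lower half (tree, kernel) + the census
`Σ_Q 1/a_Q ≤ (3/π² + o(1)) log² h_K` (`ν(a) ≤ 2^{ω(a)}`, `Σ 2^{ω(n)}/n ∼ (3/π²)log²`) + `h(d_K) = h_K`,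
`h_K ≤ π⁻¹√|d_K| log|d_K|`. [cite: RalaivaosaonaRazakarinoro2026, Theorem 2] -/
theorem ralaivaosaonaRazakarinoro2026_theorem2_holds : ralaivaosaonaRazakarinoro2026_theorem2 := by
  intro ε hε
  obtain ⟨h₀, H⟩ := one_sub_realZero_gt_of_classNumber_ge hε
  refine ⟨h₀, ?_⟩
  intro K _ _ _ h2 hneg hd hh χ hquad hprim hodd β hβ hz
  have hdZ : -((NumberField.discr K).natAbs : ℤ) = NumberField.discr K := by
    rw [Int.ofNat_natAbs_of_nonpos hneg.le]; ring
  have hd4 : 4 < (NumberField.discr K).natAbs := by omega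
  -- `h(d_K) = h_K`
  have hcard : BinaryQuadraticForm.classNumber (-((NumberField.discr K).natAbs : ℤ)) =
      NumberField.classNumber K := by
    rw [hdZ]; exact card_reducedForms_eq_classNumber h2 hneg
  -- `h_K ≤ √d log d/π`
  have hdisc4 : NumberField.discr K < -4 := by omega
  have hub : (BinaryQuadraticForm.classNumber (-((NumberField.discr K).natAbs : ℤ)) : ℝ) ≤
      Real.sqrt ((NumberField.discr K).natAbs : ℝ) * Real.log ((NumberField.discr K).natAbs : ℝ) /
        Real.pi := by
    rw [hcard]
    have h := classNumber_le_sqrt_mul_log h2 hdisc4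
    have habs : |(NumberField.discr K : ℝ)| = ((NumberField.discr K).natAbs : ℝ) := by
      rw [Nat.cast_natAbs, Int.cast_abs]
    rw [habs] at h
    calc (NumberField.classNumber K : ℝ)
        ≤ Real.pi⁻¹ * Real.sqrt ((NumberField.discr K).natAbs : ℝ) *
            Real.log ((NumberField.discr K).natAbs : ℝ) := h
      _ = Real.sqrt ((NumberField.discr K).natAbs : ℝ) * Real.log ((NumberField.discr K).natAbs : ℝ) /
            Real.pi := by ring
  have hh' : h₀ ≤ BinaryQuadraticForm.classNumber (-((NumberField.discr K).natAbs : ℤ)) := by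
    rw [hcard]; exact hh
  have key := H (NumberField.discr K).natAbs hd4 χ hprim hquad hodd β hz hh' hub
  rw [hcard] at key
  exact key

end Literature.NumberTheory.LFunctions

end
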